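import Literature.AlgebraicGeometry.LaurentSchroer2023.ParaAbelianGroupLawHolds
import Literature.AlgebraicGeometry.Limits.FiniteTypeModelDescent
import Literature.AlgebraicGeometry.Motives.AbelianVarietyIsoOfScheme
import Literature.AlgebraicGeometry.Motives.AbelianVarietyBaseChange
import Literature.AlgebraicGeometry.Motives.ProjectiveDescentProperProofs
import Mathlib.RingTheory.TensorProduct.Nontrivial
import HarnessLib

/-!
# An abelian variety is defined over a finitely generated subfield (EGA IV₃ 8.8.2; Milne, AV §20)

Topic `Literature/AlgebraicGeometry/Motives`. **`AbelianVariety.exists_finset_subfield_descent`**: for an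
abelian variety `A` over an ARBITRARY field `k′` there is a finite set `s ⊆ k′` such that for every
subfield `k₁ ⊆ k′` containing `s` there are an abelian variety `A₁` over `k₁` and an isomorphism of
abelian varieties `A₁ ×_{k₁} k′ ≅ A` over `k′` ("`A` is defined over a subfield finitely generated over
the prime field": Milne, *Abelian Varieties*, proof of Cor. 20.4 / Rem. 20.9; EGA IV₃ Thm. 8.8.2 with the
descent of properness and geometric integrality along `Spec k′ → Spec k₁`). Letting the user choose `k₁`
(any subfield containing `s`) is what the application to [AbsTopIII] Rmk. 1.5.4 (iii) needs (route
F-0371 of the cell abc-iut, junction K0: `k₁` is taken among the fields `ℚ_p(x_J)(b)` over which `k′`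
is purely transcendental).

## Proof (tree bricks by name)

1. EGA IV₃ 8.8.2 (ii) for the SCHEME: `Limits.exists_isPullback_specMap_subalgebra` (`K := ℤ`,
   `B := k′`) gives a finitely generated subring `R ⊆ k′` and a separated finite-type `X′ → Spec R`
   with `X′ ×_R k′ ≅ A`; base change to the subfield `k₀ ⊆ k′` generated by `R` gives a `k₀`-scheme
   `P` with `P ⊗_{k₀} k′ ≅ A.X` over `k′`.
2. EGA IV₃ 8.8.2 (i) for the GROUP LAW: `Limits.SubalgGrpSpread.exists_stage_grpObj` (the twin of the
   tree's Néron-model descent, used verbatim in `LaurentSchroer2023/ParaAbelianGroupLawHolds`): the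
   group structure of `A.X ≅ P ⊗_{k₀} k′` descends to a stage `P ⊗_{k₀} k₀[t]`, `t ⊆ k′` finite.
3. For a subfield `k₁ ⊇ R ∪ t`: base change of the stage group scheme along `k₀[t] → k₁` (monoidal,
   `Functor.grpObjObj`) is a group scheme `P₁` over `k₁` with `P₁ ⊗_{k₁} k′ ≅ A.X`
   (`Limits.pullbackFacObjIso` twice); `P₁ → Spec k₁` is separated and proper by fpqc descent along
   `Spec k′ → Spec k₁` (`LaurentSchroer2023.isSeparated_of_isPullback`,
   `Morphisms.FiniteEtaleFpqcDescent.isProper_of_isPullback`) and GEOMETRICALLY INTEGRAL by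
   `geometricallyIntegral_of_isPullback_of_field` below (a field `K ⊇ k₁` and `k′` have a common
   overfield `Ω = (K ⊗_{k₁} k′)/𝔪`; `P₁ ⊗ Ω` is a base change of `A`, hence integral, and covers
   `P₁ ⊗ K` flat-surjectively) — the transcendental-extension form of
   `GaloisDescentAbelianVariety.geometricallyIntegral_of_isPullback`.
4. The `k′`-isomorphism of schemes `A₁ ×_{k₁} k′ ≅ A.X` is an isomorphism of abelian varieties by
   rigidity (`AbelianVariety.isoOfOverIso'`, Milne AV Cor. 2.2 / Rem. 2.3).

Everything is proved; no definitions, no named facts.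

## References

* A. Grothendieck, EGA IV₃ (Publ. Math. IHÉS 28, 1966), Thm. 8.8.2, Thm. 8.10.5. [EGAIV3]
* J. S. Milne, *Abelian Varieties*, in Cornell–Silverman (1986), §20, proof of Cor. 20.4, Rem. 20.9;
  §2 Cor. 2.2, Rem. 2.3. [Milne1986AbelianVarieties]
* U. Görtz, T. Wedhorn, *Algebraic Geometry I*, 2nd ed. (2020), Thm. 10.66, Cor. 10.67, Thm. 10.63,
  Prop. 14.51, Prop. 14.53, Example 14.55. [GortzWedhorn2020]
-/

noncomputable section

open CategoryTheory CategoryTheory.Limits AlgebraicGeometry MonoidalCategory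
  CartesianMonoidalCategory MonObj
open scoped TensorProduct

universe u

namespace Literature.AlgebraicGeometry.Motives

set_option backward.isDefEq.respectTransparency false

/-! ### Geometric integrality descends along an arbitrary extension of the ground field -/

/-- **Geometric integrality descends along any ground-field extension** (Görtz–Wedhorn I, Prop. 5.51 /
Rem. 5.52: geometric integrality may be tested after any field extension; EGA IV₂ 4.6). In a cartesian
square `X → Spec L`, `π : X → Y₀ → Spec k` over `Spec L → Spec k` (`L ⊇ k` ANY field extension), if
`X → Spec L` is geometrically integral then so is `Y₀ → Spec k`: for a field `K ⊇ k`, a maximal ideal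
of `K ⊗_k L ≠ 0` gives a field `Ω` over both `K` and `L`; `Y₀ ×_k Ω` is a base change of `X → Spec L`,
hence integral, and covers `Y₀ ×_k K` by a flat surjection. (The algebraic case, via `K̄`, is
`GaloisDescentAbelianVariety.geometricallyIntegral_of_isPullback`.) [cite: GortzWedhorn2020, Prop. 5.51 and Rem. 5.52] -/
theorem geometricallyIntegral_of_isPullback_of_field {k : Type u} [Field k] (L : Type u) [Field L]
    [Algebra k L] {X Y₀ : Scheme.{u}} (p : X ⟶ Spec (.of L)) (π : X ⟶ Y₀)
    (q : Y₀ ⟶ Spec (.of k))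
    (H : IsPullback π p q (Spec.map (CommRingCat.ofHom (algebraMap k L))))
    [GeometricallyIntegral p] : GeometricallyIntegral q := by
  refine ⟨(geometrically_iff_of_commRing (f := q)).mpr fun K _ _ Y fst snd h ↦ ?_⟩
  -- a common overfield `Ω` of `K` and `L` over `k`
  haveI : Nontrivial (K ⊗[k] L) := inferInstance
  obtain ⟨𝔪, h𝔪⟩ := Ideal.exists_maximal (K ⊗[k] L)
  let Ω : Type u := (K ⊗[k] L) ⧸ 𝔪
  letI : Field Ω := Ideal.Quotient.field 𝔪
  -- `Ω` as a `K`-algebra and the `k`-algebra map `ψ : L → Ω`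
  letI : Algebra K Ω := ((Ideal.Quotient.mk 𝔪).comp
    (Algebra.TensorProduct.includeLeft (R := k) (S := k) (A := K) (B := L)).toRingHom).toAlgebra
  let ψ : L →ₐ[k] Ω :=
    (Ideal.Quotient.mkₐ k 𝔪).comp (Algebra.TensorProduct.includeRight (R := k) (A := K) (B := L))
  have hKΩ : (algebraMap K Ω).comp (algebraMap k K) = (ψ : L →+* Ω).comp (algebraMap k L) := by
    ext x
    change Ideal.Quotient.mk 𝔪 (algebraMap k K x ⊗ₜ[k] (1 : L)) =
      Ideal.Quotient.mk 𝔪 ((1 : K) ⊗ₜ[k] algebraMap k L x)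
    rw [← Algebra.TensorProduct.algebraMap_apply (R := k) (S := k) (A := K) (B := L) x,
      Algebra.TensorProduct.algebraMap_apply']
  -- `Y' = Y ×_K Ω`, a base change of `Y₀` along `k → Ω`
  let g : Spec (.of Ω) ⟶ Spec (.of K) := Spec.map (CommRingCat.ofHom (algebraMap K Ω))
  have hbig : IsPullback (pullback.fst snd g ≫ fst) (pullback.snd snd g) q
      (g ≫ Spec.map (CommRingCat.ofHom (algebraMap k K))) :=
    (IsPullback.of_hasPullback snd g).paste_horiz h
  -- the same `k → Ω` factors through `ψ : L → Ω`
  have hfac : g ≫ Spec.map (CommRingCat.ofHom (algebraMap k K)) =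
      Spec.map (CommRingCat.ofHom (ψ : L →+* Ω)) ≫ Spec.map (CommRingCat.ofHom (algebraMap k L)) := by
    rw [← Spec.map_comp, ← Spec.map_comp, ← CommRingCat.ofHom_comp, ← CommRingCat.ofHom_comp, hKΩ]
  -- lift `Y' → X` through the given square: a cartesian square over `Spec ψ`
  let t : pullback snd g ⟶ X := H.lift (pullback.fst snd g ≫ fst)
    (pullback.snd snd g ≫ Spec.map (CommRingCat.ofHom (ψ : L →+* Ω)))
    (by have w := hbig.w; rw [hfac] at w; simpa only [Category.assoc] using w)
  have ht₁ : t ≫ π = pullback.fst snd g ≫ fst := H.lift_fst _ _ _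
  have ht₂ : t ≫ p = pullback.snd snd g ≫ Spec.map (CommRingCat.ofHom (ψ : L →+* Ω)) :=
    H.lift_snd _ _ _
  have hbig' : IsPullback (t ≫ π) (pullback.snd snd g) q
      (Spec.map (CommRingCat.ofHom (ψ : L →+* Ω)) ≫
        Spec.map (CommRingCat.ofHom (algebraMap k L))) := by
    rw [ht₁, ← hfac]; exact hbig
  have hleft : IsPullback t (pullback.snd snd g) p (Spec.map (CommRingCat.ofHom (ψ : L →+* Ω))) :=
    IsPullback.of_right hbig' ht₂ H
  haveI : IsIntegral (pullback snd g) :=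
    GeometricallyIntegral.geometrically_isIntegral (f := p) _ _ _ hleft
  -- descend integrality along the flat surjection `Y' → Y`
  haveI : Surjective g := (ProperDescent.fpqc_specMap K Ω).1.1
  haveI : Flat g := (ProperDescent.fpqc_specMap K Ω).1.2
  haveI : Surjective (pullback.fst snd g) := MorphismProperty.pullback_fst _ _ inferInstance
  haveI : Flat (pullback.fst snd g) := MorphismProperty.pullback_fst _ _ inferInstance
  exact LaurentSchroer2023.isIntegral_of_flat_of_surjective (pullback.fst snd g)

/-! ### Abelian varieties descend to finitely generated subfields -/

namespace AbelianVariety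

open Literature.AlgebraicGeometry.Limits

/-- Elements of a ring of finite type over `ℤ` map into any subfield containing the images of a
generating set. Routine. [folklore] -/
private theorem range_subset_subfield_of_adjoin_eq_top {R₀ k' : Type u} [CommRing R₀] [Field k']
    (ψ : R₀ →+* k') (s₀ : Finset R₀) (hs₀ : Algebra.adjoin ℤ (s₀ : Set R₀) = ⊤) (k₁ : Subfield k')
    (h : ∀ x ∈ s₀, ψ x ∈ k₁) : ∀ x : R₀, ψ x ∈ k₁ := by
  intro x
  have hx : x ∈ Algebra.adjoin ℤ (s₀ : Set R₀) := by rw [hs₀]; trivial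
  induction hx using Algebra.adjoin_induction with
  | mem y hy => exact h y hy
  | algebraMap n => rw [eq_intCast, map_intCast]; exact intCast_mem k₁ n
  | add y z _ _ hy hz => rw [map_add]; exact add_mem hy hz
  | mul y z _ _ hy hz => rw [map_mul]; exact mul_mem hy hz

/-- **An abelian variety is defined over a finitely generated subfield** (Milne, *Abelian Varieties*,
proof of Cor. 20.4 / Rem. 20.9; EGA IV₃ Thm. 8.8.2): for an abelian variety `A` over a field `k′`
there is a finite `s ⊆ k′` such that for every subfield `k₁ ⊆ k′` containing `s` there are an
abelian variety `A₁` over `k₁` and an isomorphism of abelian varieties `A₁ ×_{k₁} k′ ≅ A`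
(see the module docstring for the route through the tree's EGA IV₃ §8 library).
[cite: Milne1986AbelianVarieties, §20, proof of Cor. 20.4 and Rem. 20.9] [cite: EGAIV3, Thm. 8.8.2] -/
theorem exists_finset_subfield_descent {k' : Type u} [Field k'] (A : AbelianVariety k') :
    ∃ s : Finset k', ∀ k₁ : Subfield k', (↑s : Set k') ⊆ k₁ →
      ∃ A₁ : AbelianVariety k₁, Nonempty (A₁.baseChange k' ≅ A) := by
  classical
  -- (1) the scheme `A` descends to a finitely generated ring `R₀ ↪ k'`
  haveI : LocallyOfFiniteType A.X.hom := A.isProper.toLocallyOfFiniteType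
  obtain ⟨R₀, _, ψ, X', p', π, hft, _, hψ, hsep, hlft, hqc, hsq⟩ :=
    exists_isPullback_specMap_of_isNoetherianRing A.X.hom
  haveI := hsep; haveI := hlft; haveI := hqc
  obtain ⟨s₀, hs₀⟩ := Algebra.FiniteType.out (R := ℤ) (A := R₀)
  -- the subfield `k₀ ⊆ k'` generated by `R₀`, and `P = X' ×_{R₀} k₀`
  let k₀ : Subfield k' := Subfield.closure (Set.range ψ)
  have hψk₀ : ∀ x, ψ x ∈ k₀ := fun x => Subfield.subset_closure ⟨x, rfl⟩
  let ψ₀ : R₀ →+* k₀ := ψ.codRestrict k₀ hψk₀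
  have hψ₀ : (algebraMap k₀ k').comp ψ₀ = ψ := RingHom.ext fun _ => rfl
  let i₀ : Spec (.of (k₀ : Type u)) ⟶ Spec (.of R₀) := Spec.map (CommRingCat.ofHom ψ₀)
  let P : SchemeOver (k₀ : Type u) := (Over.pullback i₀).obj (Over.mk p')
  -- the cover `j : Spec k' → Spec k₀` and `P ⊗_{k₀} k' ≅ A.X`
  let j : Spec (.of k') ⟶ Spec (.of (k₀ : Type u)) :=
    Spec.map (CommRingCat.ofHom (algebraMap k₀ k'))
  have hj : j ≫ i₀ = Spec.map (CommRingCat.ofHom ψ) := by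
    rw [← Spec.map_comp, ← CommRingCat.ofHom_comp, hψ₀]
  let χ : A.X ≅ (Over.pullback (Spec.map (CommRingCat.ofHom ψ))).obj (Over.mk p') :=
    Over.isoMk hsq.isoPullback (hsq.isoPullback_hom_snd)
  let PB : SchemeOver k' := SubalgGrpSpread.limObj k' P
  have φ' : A.X ≅ PB :=
    χ ≪≫ (pullbackFacObjIso i₀ j (Spec.map (CommRingCat.ofHom ψ)) hj (Over.mk p')).symm
  -- (2) transport the group structure and spread it out to a stage `P ⊗_{k₀} k₀[t]`
  letI instPB : GrpObj PB := GrpObj.ofIso φ'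
  haveI : QuasiCompact P.hom := MorphismProperty.pullback_snd _ _ hqc
  haveI : IsSeparated P.hom := MorphismProperty.pullback_snd _ _ hsep
  haveI : LocallyOfFiniteType P.hom := MorphismProperty.pullback_snd _ _ hlft
  haveI : LocallyOfFinitePresentation P.hom := inferInstance
  haveI : Flat P.hom := inferInstance
  obtain ⟨t, Gt, -⟩ := SubalgGrpSpread.exists_stage_grpObj k' (∅ : Finset k') P
  -- (3) the finite set: generators of `R₀` and the stage `t`
  refine ⟨s₀.image ψ ∪ t.unop.1, fun k₁ hk₁ => ?_⟩
  -- `R₀ ⊆ k₁`, `k₀ ⊆ k₁`, `k₀[t] ⊆ k₁`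
  have hψk₁ : ∀ x, ψ x ∈ k₁ :=
    range_subset_subfield_of_adjoin_eq_top ψ s₀ hs₀ k₁ fun x hx =>
      hk₁ (Finset.mem_union_left _ (Finset.mem_image_of_mem ψ hx))
  have hk₀k₁ : k₀ ≤ k₁ := Subfield.closure_le.mpr (by rintro _ ⟨x, rfl⟩; exact hψk₁ x)
  let St : Subalgebra k₀ k' := SubalgApprox.sub k₀ k' t.unop.1
  let k₁' : Subalgebra k₀ k' :=
    { carrier := (k₁ : Set k')
      mul_mem' := fun ha hb => k₁.mul_mem ha hb
      one_mem' := k₁.one_mem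
      add_mem' := fun ha hb => k₁.add_mem ha hb
      zero_mem' := k₁.zero_mem
      algebraMap_mem' := fun c => hk₀k₁ c.2 }
  have hSt : St ≤ k₁' := Algebra.adjoin_le fun x hx => hk₁ (Finset.mem_union_right _ hx)
  let ρ : St →+* k₁ := St.val.toRingHom.codRestrict k₁ fun x => hSt x.2
  have hρ : (algebraMap k₁ k').comp ρ = St.val.toRingHom := RingHom.ext fun _ => rfl
  -- (4) base change of the stage group scheme to `k₁`
  let T := (SubalgApprox.baseDiagram (k₀ : Type u) k' (∅ : Finset k')).obj t
  let jρ : Spec (.of (k₁ : Type u)) ⟶ T.left := Spec.map (CommRingCat.ofHom ρ)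
  let P₁ : SchemeOver (k₁ : Type u) := (Over.pullback jρ).obj (SubalgGrpSpread.stageObj k' ∅ P t)
  letI := Gt
  letI G₁ : GrpObj P₁ :=
    Functor.grpObjObj (F := Over.pullback jρ) (G := SubalgGrpSpread.stageObj k' ∅ P t)
  -- `P₁ ⊗_{k₁} k' ≅ A.X` over `k'`
  let j₁ : Spec (.of k') ⟶ Spec (.of (k₁ : Type u)) :=
    Spec.map (CommRingCat.ofHom (algebraMap k₁ k'))
  have hleg : j₁ ≫ jρ = (SubalgGrpSpread.baseLeg (k₀ : Type u) k' ∅ t).left := by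
    rw [SubalgApprox.baseCone_π_app_left, ← Spec.map_comp, ← CommRingCat.ofHom_comp, hρ]
    rfl
  let ψ₁ : (Literature.AlgebraicGeometry.Motives.baseChange (k₁ : Type u) k').obj P₁ ≅ A.X :=
    pullbackFacObjIso jρ j₁ _ hleg (SubalgGrpSpread.stageObj k' ∅ P t) ≪≫
      SubalgGrpSpread.legFacObjIso k' ∅ t P ≪≫ φ'.symm
  -- (5) properties of `P₁ → Spec k₁` by descent along `Spec k' → Spec k₁`
  have hbc : IsPullback (pullback.fst P₁.hom j₁)
      ((Literature.AlgebraicGeometry.Motives.baseChange (k₁ : Type u) k').obj P₁).hom P₁.hom j₁ :=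
    IsPullback.of_hasPullback P₁.hom j₁
  haveI : Surjective j₁ := (ProperDescent.fpqc_specMap (k₁ : Type u) k').1.1
  haveI : Flat j₁ := (ProperDescent.fpqc_specMap (k₁ : Type u) k').1.2
  haveI : IsProper ((Literature.AlgebraicGeometry.Motives.baseChange (k₁ : Type u) k').obj P₁).hom := by
    have e1 : ((Literature.AlgebraicGeometry.Motives.baseChange (k₁ : Type u) k').obj P₁).hom =
        ψ₁.hom.left ≫ A.X.hom := (Over.w ψ₁.hom).symm
    rw [e1]; infer_instance
  haveI : IsIso ψ₁.hom.left := inferInstanceAs (IsIso ((Over.forget _).mapIso ψ₁).hom)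
  haveI : GeometricallyIntegral
      ((Literature.AlgebraicGeometry.Motives.baseChange (k₁ : Type u) k').obj P₁).hom := by
    have e1 : ((Literature.AlgebraicGeometry.Motives.baseChange (k₁ : Type u) k').obj P₁).hom =
        ψ₁.hom.left ≫ A.X.hom := (Over.w ψ₁.hom).symm
    rw [e1]
    exact (MorphismProperty.cancel_left_of_respectsIso @GeometricallyIntegral ψ₁.hom.left
      A.X.hom).mpr A.geometricallyIntegral
  haveI : IsSeparated P₁.hom := LaurentSchroer2023.isSeparated_of_isPullback hbc.flip
  have hPr : IsProper P₁.hom := Morphisms.isProper_of_isPullback hbc.flip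
  have hGI : GeometricallyIntegral P₁.hom :=
    geometricallyIntegral_of_isPullback_of_field k'
      ((Literature.AlgebraicGeometry.Motives.baseChange (k₁ : Type u) k').obj P₁).hom
      (pullback.fst P₁.hom j₁) P₁.hom hbc
  -- (6) the abelian variety `A₁` and the isomorphism `A₁ ×_{k₁} k' ≅ A` (rigidity)
  let A₁ : AbelianVariety (k₁ : Type u) :=
    { X := P₁, grpObj := G₁, isProper := hPr, geometricallyIntegral := hGI }
  exact ⟨A₁, ⟨AbelianVariety.isoOfOverIso' (B := A₁.baseChange k') (C := A) ψ₁⟩⟩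

/-- **An abelian variety is defined over a finitely generated subfield — `IntermediateField` form**
(same statement and proof as `exists_finset_subfield_descent`, for subfields of `k′` given as
intermediate fields over a base field `F`, e.g. `F = ℚ_p`, the spelling of the tree's Kummer-faithful
files): for an abelian variety `A` over `k′ ⊇ F` there is a finite `s ⊆ k′` such that for every
intermediate field `F ⊆ k₁ ⊆ k′` containing `s` there are an abelian variety `A₁` over `k₁` and an
isomorphism of abelian varieties `A₁ ×_{k₁} k′ ≅ A`.
[cite: Milne1986AbelianVarieties, §20, proof of Cor. 20.4 and Rem. 20.9] [cite: EGAIV3, Thm. 8.8.2] -/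
theorem exists_finset_intermediateField_descent {F : Type u} [Field F] {k' : Type u} [Field k']
    [Algebra F k'] (A : AbelianVariety k') :
    ∃ s : Finset k', ∀ k₁ : IntermediateField F k', (↑s : Set k') ⊆ k₁ →
      ∃ A₁ : AbelianVariety k₁, Nonempty (A₁.baseChange k' ≅ A) := by
  classical
  -- (1) the scheme `A` descends to a finitely generated ring `R₀ ↪ k'`
  haveI : LocallyOfFiniteType A.X.hom := A.isProper.toLocallyOfFiniteType
  obtain ⟨R₀, _, ψ, X', p', π, hft, _, hψ, hsep, hlft, hqc, hsq⟩ :=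
    exists_isPullback_specMap_of_isNoetherianRing A.X.hom
  haveI := hsep; haveI := hlft; haveI := hqc
  obtain ⟨s₀, hs₀⟩ := Algebra.FiniteType.out (R := ℤ) (A := R₀)
  -- the subfield `k₀ ⊆ k'` generated by `R₀`, and `P = X' ×_{R₀} k₀`
  let k₀ : Subfield k' := Subfield.closure (Set.range ψ)
  have hψk₀ : ∀ x, ψ x ∈ k₀ := fun x => Subfield.subset_closure ⟨x, rfl⟩
  let ψ₀ : R₀ →+* k₀ := ψ.codRestrict k₀ hψk₀
  have hψ₀ : (algebraMap k₀ k').comp ψ₀ = ψ := RingHom.ext fun _ => rfl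
  let i₀ : Spec (.of (k₀ : Type u)) ⟶ Spec (.of R₀) := Spec.map (CommRingCat.ofHom ψ₀)
  let P : SchemeOver (k₀ : Type u) := (Over.pullback i₀).obj (Over.mk p')
  -- the cover `j : Spec k' → Spec k₀` and `P ⊗_{k₀} k' ≅ A.X`
  let j : Spec (.of k') ⟶ Spec (.of (k₀ : Type u)) :=
    Spec.map (CommRingCat.ofHom (algebraMap k₀ k'))
  have hj : j ≫ i₀ = Spec.map (CommRingCat.ofHom ψ) := by
    rw [← Spec.map_comp, ← CommRingCat.ofHom_comp, hψ₀]
  let χ : A.X ≅ (Over.pullback (Spec.map (CommRingCat.ofHom ψ))).obj (Over.mk p') :=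
    Over.isoMk hsq.isoPullback (hsq.isoPullback_hom_snd)
  let PB : SchemeOver k' := SubalgGrpSpread.limObj k' P
  have φ' : A.X ≅ PB :=
    χ ≪≫ (pullbackFacObjIso i₀ j (Spec.map (CommRingCat.ofHom ψ)) hj (Over.mk p')).symm
  -- (2) transport the group structure and spread it out to a stage `P ⊗_{k₀} k₀[t]`
  letI instPB : GrpObj PB := GrpObj.ofIso φ'
  haveI : QuasiCompact P.hom := MorphismProperty.pullback_snd _ _ hqc
  haveI : IsSeparated P.hom := MorphismProperty.pullback_snd _ _ hsep
  haveI : LocallyOfFiniteType P.hom := MorphismProperty.pullback_snd _ _ hlft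
  haveI : LocallyOfFinitePresentation P.hom := inferInstance
  haveI : Flat P.hom := inferInstance
  obtain ⟨t, Gt, -⟩ := SubalgGrpSpread.exists_stage_grpObj k' (∅ : Finset k') P
  -- (3) the finite set: generators of `R₀` and the stage `t`
  refine ⟨s₀.image ψ ∪ t.unop.1, fun k₁ hk₁ => ?_⟩
  -- `R₀ ⊆ k₁`, `k₀ ⊆ k₁`, `k₀[t] ⊆ k₁`
  have hψk₁ : ∀ x, ψ x ∈ k₁ :=
    range_subset_subfield_of_adjoin_eq_top ψ s₀ hs₀ k₁.toSubfield fun x hx =>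
      hk₁ (Finset.mem_union_left _ (Finset.mem_image_of_mem ψ hx))
  have hk₀k₁ : k₀ ≤ k₁.toSubfield := Subfield.closure_le.mpr (by rintro _ ⟨x, rfl⟩; exact hψk₁ x)
  let St : Subalgebra k₀ k' := SubalgApprox.sub k₀ k' t.unop.1
  let k₁' : Subalgebra k₀ k' :=
    { carrier := (k₁ : Set k')
      mul_mem' := fun ha hb => k₁.mul_mem ha hb
      one_mem' := k₁.one_mem
      add_mem' := fun ha hb => k₁.add_mem ha hb
      zero_mem' := k₁.zero_mem
      algebraMap_mem' := fun c => (hk₀k₁ c.2 : (c : k') ∈ k₁.toSubfield) }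
  have hSt : St ≤ k₁' := Algebra.adjoin_le fun x hx => hk₁ (Finset.mem_union_right _ hx)
  let ρ : St →+* k₁ := St.val.toRingHom.codRestrict k₁ fun x => hSt x.2
  have hρ : (algebraMap k₁ k').comp ρ = St.val.toRingHom := RingHom.ext fun _ => rfl
  -- (4) base change of the stage group scheme to `k₁`
  let T := (SubalgApprox.baseDiagram (k₀ : Type u) k' (∅ : Finset k')).obj t
  let jρ : Spec (.of (k₁ : Type u)) ⟶ T.left := Spec.map (CommRingCat.ofHom ρ)
  let P₁ : SchemeOver (k₁ : Type u) := (Over.pullback jρ).obj (SubalgGrpSpread.stageObj k' ∅ P t)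
  letI := Gt
  letI G₁ : GrpObj P₁ :=
    Functor.grpObjObj (F := Over.pullback jρ) (G := SubalgGrpSpread.stageObj k' ∅ P t)
  -- `P₁ ⊗_{k₁} k' ≅ A.X` over `k'`
  let j₁ : Spec (.of k') ⟶ Spec (.of (k₁ : Type u)) :=
    Spec.map (CommRingCat.ofHom (algebraMap k₁ k'))
  have hleg : j₁ ≫ jρ = (SubalgGrpSpread.baseLeg (k₀ : Type u) k' ∅ t).left := by
    rw [SubalgApprox.baseCone_π_app_left, ← Spec.map_comp, ← CommRingCat.ofHom_comp, hρ]
    rfl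
  let ψ₁ : (Literature.AlgebraicGeometry.Motives.baseChange (k₁ : Type u) k').obj P₁ ≅ A.X :=
    pullbackFacObjIso jρ j₁ _ hleg (SubalgGrpSpread.stageObj k' ∅ P t) ≪≫
      SubalgGrpSpread.legFacObjIso k' ∅ t P ≪≫ φ'.symm
  -- (5) properties of `P₁ → Spec k₁` by descent along `Spec k' → Spec k₁`
  have hbc : IsPullback (pullback.fst P₁.hom j₁)
      ((Literature.AlgebraicGeometry.Motives.baseChange (k₁ : Type u) k').obj P₁).hom P₁.hom j₁ :=
    IsPullback.of_hasPullback P₁.hom j₁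
  haveI : Surjective j₁ := (ProperDescent.fpqc_specMap (k₁ : Type u) k').1.1
  haveI : Flat j₁ := (ProperDescent.fpqc_specMap (k₁ : Type u) k').1.2
  haveI : IsProper ((Literature.AlgebraicGeometry.Motives.baseChange (k₁ : Type u) k').obj P₁).hom := by
    have e1 : ((Literature.AlgebraicGeometry.Motives.baseChange (k₁ : Type u) k').obj P₁).hom =
        ψ₁.hom.left ≫ A.X.hom := (Over.w ψ₁.hom).symm
    rw [e1]; infer_instance
  haveI : IsIso ψ₁.hom.left := inferInstanceAs (IsIso ((Over.forget _).mapIso ψ₁).hom)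
  haveI : GeometricallyIntegral
      ((Literature.AlgebraicGeometry.Motives.baseChange (k₁ : Type u) k').obj P₁).hom := by
    have e1 : ((Literature.AlgebraicGeometry.Motives.baseChange (k₁ : Type u) k').obj P₁).hom =
        ψ₁.hom.left ≫ A.X.hom := (Over.w ψ₁.hom).symm
    rw [e1]
    exact (MorphismProperty.cancel_left_of_respectsIso @GeometricallyIntegral ψ₁.hom.left
      A.X.hom).mpr A.geometricallyIntegral
  haveI : IsSeparated P₁.hom := LaurentSchroer2023.isSeparated_of_isPullback hbc.flip
  have hPr : IsProper P₁.hom := Morphisms.isProper_of_isPullback hbc.flip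
  have hGI : GeometricallyIntegral P₁.hom :=
    geometricallyIntegral_of_isPullback_of_field k'
      ((Literature.AlgebraicGeometry.Motives.baseChange (k₁ : Type u) k').obj P₁).hom
      (pullback.fst P₁.hom j₁) P₁.hom hbc
  -- (6) the abelian variety `A₁` and the isomorphism `A₁ ×_{k₁} k' ≅ A` (rigidity)
  let A₁ : AbelianVariety (k₁ : Type u) :=
    { X := P₁, grpObj := G₁, isProper := hPr, geometricallyIntegral := hGI }
  exact ⟨A₁, ⟨AbelianVariety.isoOfOverIso' (B := A₁.baseChange k') (C := A) ψ₁⟩⟩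

end AbelianVariety

end Literature.AlgebraicGeometry.Motives

end
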